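import Mathlib
import Summits.MatrixMultiplication.MatrixMultiplication.Theses.LevelGradedCohnUmans
import Literature.RepresentationTheory.FiniteGroups.CharacterDegrees
import Literature.RepresentationTheory.FiniteGroups.IrreducibleCharacters
import HarnessLib.Audit
import Summits.MatrixMultiplication.MatrixMultiplication.Theorems.LevelGradedCohnUmansGradedDesignFamilyStubBlockContainment
import Summits.MatrixMultiplication.MatrixMultiplication.Theorems.LevelGradedCohnUmansGradedDesignFamilyStubFrameStructure

/-!
# Line `quadratic-extension-level-one-cell` — crux `LevelGradedCohnUmans.GradedDesignFamily`
(stmt-MatrixMultiplication-7610, the route TARGET, auto-cruxed)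

STATUS (lead c2, 2026-08-16): CLOSED MODULO ONE STUB. S1 `stub_blockContainment` LANDED
(`Theorems/LevelGradedCohnUmansGradedDesignFamilyStubBlockContainment.lean`, p120556) and S2
`stub_frameStructure` LANDED (`Theorems/LevelGradedCohnUmansGradedDesignFamilyStubFrameStructure.lean`,
p120581); `GradedDesignFamily_of (h₃ : stub_subfieldCell)` is proved below. Open: S3
`stub_subfieldCell` (the design; crux-sized). See `Lines/quadratic-extension-level-one-cell-S3.md`
for the lead's assessment (sliced horn dead by quasirandomness of `SL₂(K)`; spread horn open).

Skeleton (crux-plan, round 1) of idea card `Cruxes/GradedDesignFamily/Ideas/quadratic-extension-level-one-cell.md`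
(ideator k = 2), triage `TRIAGE-r1-1.md` / `TRIAGE-r1-2.md`: pass × 2 ("could not break it; the move is legal only
for this umbrella … lemma (a) is provable now"; r1-1 App. A sharpens the numerology by an H-equivariant wall).

CRUX (by name): `Summit.MatrixMultiplication.MatrixMultiplication.Theses.LevelGradedCohnUmans.GradedDesignFamily` —
`∀ ε > 0 ∃` finite group `G`, BI-INVARIANT `J ≤ ℂ^G`, `J`-SEPARATED `X Y Z ⊆ G` with
`Σᶠ_{χ ∈ Irr G ∩ J} χ(1)^{2+ε} < (|X||Y||Z|)^{(2+ε)/3}`.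

THE LINE. The umbrella crux quantifies over ALL finite groups, so — unlike its `ZMod p`-typed siblings
`LieRankDesigns` / `LevelOneGL2Designs` — it admits the level-one Lie cell over PRIME POWERS. Host:
`G = GL₂(K)`, `K` any finite field, `Q = |K|`; tests `J = frameSpace K` = the frame functions
`g ↦ Σ_{u ∈ K²} c u (g·u)` (sums of functions of ONE matrix–vector product = the coefficient space of the
permutation module `ℂ[K²]` = the span of `ψ(tr(M g))`, `rk M ≤ 1`, for any `ψ ≠ 1`: the route thesis' own
"frame duality" description of Fourier rank `≤ 1`; rendering it in frame form removes the additive character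
from the whole line and makes bi-invariance a ten-line reindexing, `frameSpace_biInv`). `Irr ∩ J =
{1, St, π(1,θ)}`, wall `D = Q³+Q²−3Q−1`, budget `1 + Q^s + (Q−2)(Q+1)^s`, `N_eff ≈ Q → ∞` at the FIXED cell
`(m,k) = (2,1)`, so constant-factor wall saturation along `Q → ∞` proves EVERY `ε` (universality). The idea's
bet for the design: `Q = q²` and the outer piece `X = SL₂(𝔽_q) < GL₂(𝔽_{q²})` (Cohn–Umans 2003 Prop. 11's
third group), an ALGEBRAIC subgroup of exactly the critical size `q³ − q ≈ Q^{3/2} = √D` that no prime field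
offers; with `X` a subgroup, separation is `|Z|` linear conditions (one-subgroup identity test) on two free SETS
`Y, Z`.
* S1 `stub_blockContainment` (general finite groups; size M) — bi-invariant `J` ⇒ `Σ_{χ ∈ Irr ∩ J} χ(1)² ≤ dim J`
  (a character in a two-sided ideal drags its whole Wedderburn block in). Converse of the landed
  `GradedDesignFamily.Negative.finrank_le_gradedBudget_two`; together: `dim J = Σ_J d²`, the wall identity the
  route uses everywhere.
* S2 `stub_frameStructure` (`GL₂(K)`, any finite field; size M) — (i) the frame functions are spanned by
  `≤ Q³ + Q²` functions (constants + indicators `[g u_ℓ = v]`, one probe per point of `P¹(K)`); (ii) every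
  irreducible character inside `frameSpace K` has degree `≤ Q + 1` (constituents of
  `ℂ[K²] = ℂδ₀ ⊕ ⊕_θ ℂ[K²∖0]_θ`, homogeneity eigenspaces of dimension `Q+1`). The exact decomposition is the
  tree fact `JamesLiebeck2001_ex29_3` (stated for every finite field) — not needed.
* S3 `stub_subfieldCell` — THE CLOSER (hardest; XL, open; the card's Transfer `C⁺` run with its algebraic
  piece, in ONE-SUBGROUP form): `∃ c > 0`, for unboundedly large finite fields `k ⊂ K`, `|K| = |k|²`, an
  embedding `φ : SL₂(k) ↪ GL₂(K)` (standard, `SU₂(k)`, any conjugate) and SETS `Y, Z ⊆ GL₂(K)` with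
  `|φ(SL₂ k)|, |Y|, |Z| ≥ c·Q^{3/2}` such that for every `z₀ ∈ Z` ONE frame function reads
  `F_{z₀}(φ(a) y y'⁻¹ z) = [a = 1 ∧ y = y' ∧ z = z₀]`. Equivalent to level-one separation of
  `(φ(SL₂ k), Y, Z)` (`frameSeparated_image` / `oneSubgroup_of_frameSeparated`, both PROVED). ANY constant
  `c` suffices, so both horns of the card stay open: determinant-sliced designs inside `SL₂(K)·g` (folded
  footprint, wall `D′ ≈ Q³/2`) or designs spread over `GL₂(K)` with `F₁`-degenerate garbage.
PROVED HERE (no sorry): `frameSpace` as a submodule and its BI-INVARIANCE (`frameFn_transl`,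
`frameSpace_biInv`); the one-subgroup identity test in both directions; the level-one budget over any finite
field from S1+S2, `Σ_{Irr ∩ F₁} d^s ≤ (Q+1)^{s−2}(Q³+Q²) ≤ 2^s Q^{1+s}` for `s ≥ 2` (`frameBudget_le`,
`frameBudget_le_pow`); the prime-power UNIVERSALITY bookkeeping `cruxBody_of_frameFamily` (S1 → S2 → Transfer
`C⁺` → the crux's body; the real-exponent tail is ported from the chain's kernel-checked
`Cruxes/LieRankDesigns/IdeatorSketch2.LieRankDesigns_of_levelOneGL2`: `Q^{ε/2} > (2/c)^{2+ε}`); and the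
composition `GradedDesignFamily_of : S1 → S2 → S3 → GradedDesignFamily` BY NAME.

DISPROOF USED (`Cruxes/GradedDesignFamily/Disproof.lean`, cdisprove cycle 1, VERDICT: NO KILL; no
`_false_without_<H>` theorem exists for this crux — its §1 LOAD-BEARING clauses play that role):
* `realizable_without_biInv` — bi-invariance is load-bearing: honoured, `frameSpace_biInv` PROVES it for the
  host (used at `cruxBody_of_frameFamily`).
* `realizable_without_zeros` / `_without_ones` / `realizable_with_le` — both pattern halves and strictness:
  honoured, the separation clause is produced VERBATIM from S3's `if … then 1 else 0` separators and the budget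
  inequality is strict (`hfinal`).
* `exists_abelian_witness_iff` (abelian hosts only for `ε > 1`): `GL₂(K)` is non-abelian; `witness_of_one_lt`
  not used (no trivial range).
* `nblocks_law` / `packing_law_sharp` / `no_fixed_host` (`N^ε > 2^{(2+ε)/3}`, hosts must grow): honoured by
  SHAPE — `N = #(Irr ∩ F₁) = Q` and the host `GL₂(K)` is chosen AFTER `ε` (`N ≤ |K|` with
  `|K| > ((2/c)^{2+ε})^{2/ε}`).
* `vol_le_psi` (graded Neumann `V ≤ ψ(D) ≈ 0.385 D^{3/2}`) and the landed
  `Theorems/GradedDesignFamily/Negative/Pigeonhole.card_mul_add_card_mul_le_card` (`|X||Y| + |Y||Z| ≤ |G|`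
  for proper `J`): S3 asks sides `c·Q^{3/2}` with `c ≤ 1/2` forced (`2cQ³ ≲ D = Q³+…`, `2c²Q³ ≤ Q⁴`) —
  consistent; the H-EQUIVARIANT wall of triage r1-1 App. A (`(|Y|+|Z|−1)σ(1) ≤ mult_σ(Res_H F₁)`,
  cuspidal deficit) costs a factor `(1−1/q)²` only.
* Sibling negatives checked (not importable constraints on S3, all consistent): `LevelOneGL2Designs/Negative/
  Exponent.not_levelOneGL2Designs_exp` (exponent `3/2` is tight — S3 asks exactly `Q^{3/2}`),
  `…/PermutableSubgroups` (all-SUBGROUP permutable designs never pass the wall — S3 has one subgroup and two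
  sets, as the card's census (4) demands), `…/Moat` (uncertainty principle; separators here are not required
  to be supported on the footprint).
Negatives index (`ledger negatives --problem MatrixMultiplication`, 4 items: LevelTwoBeatsCubes, ExactLineDesign,
ExactFrameDesign, SeparableDesignsMultiplicative): none restated (no S_n level, no frame-STPP over fields, no
Kronecker flattening). Dead lines: none on the item (round 1); the card's own census (4)(i)–(iii) (all-subgroup
templates, two subfield outers, Borel-type subgroup partners) is respected by S3's shape (one subgroup, two sets).

TRIAGE ANSWERS. r1-1: the advertised finite entry `GL₂(𝔽₁₆) ∋ A₅, |Y| = |Z| = 36` is EMPTY by the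
H-equivariant count (first live exponent-3 cell `Q = 49`, then `64`) — the skeleton is asymptotic (`∀ N ∃ |K| ≥ N`,
any constant `c`), so no finite cell is load-bearing; the exponent-3 milestone stays with `LieRankBeatsCubes`.
r1-2: "state lemma (a) over `Field F` + `AddChar F ℂ` and land it first" — done in the character-free frame form
(same space for every `ψ ≠ 1`), and lemma (a) is now PROVED modulo the two M-sized structure stubs S1/S2;
"start the lead at Q = 25/49 or run F1 at Q = 16 as a degeneracy probe" — recorded in the line card as the
lead's first computations, not as stubs.

Conventions as in the accepted skeletons of this route (`Cruxes/SnLevelDesigns/Lines/garnir-annihilator.lean`):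
each stub statement is a plain `def … : Prop`; the REGISTERED stubs are the sorried `theorem stub_…` spelled in
tree-only vocabulary (so a `Theorems/` helper can carry the identical name + signature); the name-keyed aliases
`Registered.stub_…` are the hypotheses of `GradedDesignFamily_of`; the closing `example` certifies that the
spellings are definitionally the named statements. Namespace `…Cruxes.GradedDesignFamily.QuadraticExtensionLevelOneCell`.
-/

set_option linter.dupNamespace false

noncomputable section

namespace Summit.MatrixMultiplication.MatrixMultiplication.Cruxes.GradedDesignFamily.QuadraticExtensionLevelOneCell

open scoped BigOperators
open Literature.RepresentationTheory.FiniteGroups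
open Summit.MatrixMultiplication.MatrixMultiplication.Theses.LevelGradedCohnUmans

/-! ## Vocabulary: the level-one host `(GL₂(K), frameSpace K)` over an arbitrary finite field -/

section Host

variable (K : Type) [Field K] [Fintype K]

/-- `GL₂(K)`; the umbrella crux quantifies over ALL finite groups, so `|K|` may be a prime power
(the typed sibling cruxes `LieRankDesigns` / `LevelOneGL2Designs` are rendered over `ZMod p`). -/
abbrev GL2 : Type := Matrix.GeneralLinearGroup (Fin 2) K

variable {K}

/-- The level-one ("frame") test function with coefficient table `c`: `g ↦ Σ_{u ∈ K²} c u (g·u)` — a sum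
of functions of ONE matrix–vector product (the route's frame-duality description of Fourier rank `≤ 1`;
for any non-trivial additive character `ψ` of `K` this is the span of `g ↦ ψ(tr(M g))`, `rk M ≤ 1`). -/
def frameFn (c : (Fin 2 → K) → (Fin 2 → K) → ℂ) (g : GL2 K) : ℂ :=
  ∑ u : Fin 2 → K, c u ((g : Matrix (Fin 2) (Fin 2) K).mulVec u)

variable (K)

/-- The level-one test space `F₁(K) ≤ ℂ^{GL₂(K)}`: all frame functions (= the coefficient space of
the permutation module `ℂ[K²]`; `Irr ∩ F₁ = {1, St, π(1,θ) : θ ≠ 1}`, `dim = Q³+Q²−3Q−1`, `Q = |K|`). -/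
def frameSpace : Submodule ℂ (GL2 K → ℂ) where
  carrier := {f | ∃ c : (Fin 2 → K) → (Fin 2 → K) → ℂ, ∀ g, f g = frameFn c g}
  add_mem' := by
    rintro f₁ f₂ ⟨c₁, h₁⟩ ⟨c₂, h₂⟩
    refine ⟨fun u v => c₁ u v + c₂ u v, fun g => ?_⟩
    simp only [Pi.add_apply, h₁ g, h₂ g, frameFn, Finset.sum_add_distrib]
  zero_mem' := ⟨fun _ _ => 0, fun g => by simp [frameFn]⟩
  smul_mem' := by
    rintro r f ⟨c, h⟩
    refine ⟨fun u v => r * c u v, fun g => ?_⟩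
    simp only [Pi.smul_apply, smul_eq_mul, h g, frameFn, Finset.mul_sum]

theorem mem_frameSpace {f : GL2 K → ℂ} :
    f ∈ frameSpace K ↔ ∃ c : (Fin 2 → K) → (Fin 2 → K) → ℂ, ∀ g, f g = frameFn c g :=
  Iff.rfl

variable {K}

theorem frameFn_mem (c : (Fin 2 → K) → (Fin 2 → K) → ℂ) : frameFn c ∈ frameSpace K :=
  ⟨c, fun _ => rfl⟩

/-- `u ↦ b·u` is a permutation of `K²` for `b ∈ GL₂(K)`. -/
def mulVecEquiv (b : GL2 K) : (Fin 2 → K) ≃ (Fin 2 → K) where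
  toFun u := (b : Matrix (Fin 2) (Fin 2) K).mulVec u
  invFun u := ((b⁻¹ : GL2 K) : Matrix (Fin 2) (Fin 2) K).mulVec u
  left_inv u := by
    simp only [Matrix.mulVec_mulVec]
    rw [← Units.val_mul, inv_mul_cancel, Units.val_one, Matrix.one_mulVec]
  right_inv u := by
    simp only [Matrix.mulVec_mulVec]
    rw [← Units.val_mul, mul_inv_cancel, Units.val_one, Matrix.one_mulVec]

/-- **Bi-invariance by reindexing**: `g ↦ F_c(a g b)` is the frame function of the table
`(u, v) ↦ c (b⁻¹u) (a v)` (substitute `u ↦ b u`). [folklore] -/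
theorem frameFn_transl (c : (Fin 2 → K) → (Fin 2 → K) → ℂ) (a b g : GL2 K) :
    frameFn c (a * g * b) =
      frameFn (fun u v => c (((b⁻¹ : GL2 K) : Matrix (Fin 2) (Fin 2) K).mulVec u)
        ((a : Matrix (Fin 2) (Fin 2) K).mulVec v)) g := by
  unfold frameFn
  refine Fintype.sum_equiv (mulVecEquiv b) _ _ fun u => ?_
  have hu : ((b⁻¹ : GL2 K) : Matrix (Fin 2) (Fin 2) K).mulVec
      ((b : Matrix (Fin 2) (Fin 2) K).mulVec u) = u := (mulVecEquiv b).left_inv u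
  simp only [mulVecEquiv, Equiv.coe_fn_mk, hu, Matrix.mulVec_mulVec, ← Units.val_mul, mul_assoc]

variable (K)

/-- The level-one test space is BI-INVARIANT (the crux's first clause, verbatim). -/
theorem frameSpace_biInv :
    ∀ f ∈ frameSpace K, ∀ a b : GL2 K, (fun g : GL2 K => f (a * g * b)) ∈ frameSpace K := by
  rintro f ⟨c, hc⟩ a b
  exact ⟨_, fun g => (hc (a * g * b)).trans (frameFn_transl c a b g)⟩

variable {K}
variable [DecidableEq K]

/-- Level-one ("frame") separation of a triple in `GL₂(K)`: the crux's separation clause with the test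
drawn from `frameSpace K`, written with its coefficient table. -/
def FrameSeparated (X Y Z : Finset (GL2 K)) : Prop :=
  ∀ x₀ ∈ X, ∀ z₀ ∈ Z, ∃ c : (Fin 2 → K) → (Fin 2 → K) → ℂ, ∀ x ∈ X, ∀ y ∈ Y, ∀ y' ∈ Y, ∀ z ∈ Z,
    frameFn c (x⁻¹ * y * y'⁻¹ * z) = if x = x₀ ∧ y = y' ∧ z = z₀ then 1 else 0

end Host

/-- **Transfer `C⁺` of the card (prime-power universality input)**: level-one separated triples in
`GL₂(K)` of sides `≥ c·|K|^{3/2}` along finite fields `K` of unbounded order. -/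
def LevelOneFrameFamily : Prop :=
  ∃ c : ℝ, 0 < c ∧ ∀ N : ℕ, ∃ (K : Type) (_ : Field K) (_ : Fintype K) (_ : DecidableEq K),
    N ≤ Fintype.card K ∧ ∃ X Y Z : Finset (GL2 K), FrameSeparated X Y Z ∧
      c * (Fintype.card K : ℝ) ^ (3 / 2 : ℝ) ≤ X.card ∧
      c * (Fintype.card K : ℝ) ^ (3 / 2 : ℝ) ≤ Y.card ∧
      c * (Fintype.card K : ℝ) ^ (3 / 2 : ℝ) ≤ Z.card

/-! ## S1 — block containment (general finite groups; size M) -/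

/-- **S1 `BlockContainment`.** For a finite group `G` and a BI-INVARIANT `J ≤ ℂ^G`,
`Σ_{χ ∈ Irr(G) ∩ J} χ(1)² ≤ dim J`: if `χ_ρ ∈ J` then the whole Wedderburn block (coefficient space)
`M_ρ ⊆ J`, because `J` is a two-sided ideal of `ℂ[G]` and `M_ρ` is the minimal two-sided ideal
containing `χ_ρ`; distinct blocks are independent of dimensions `d_ρ²`. The converse inequality
`dim J ≤ Σ χ(1)²` is `Disproof.finrank_le_budget_two` (landed transfer `le_repFun_charSupport` of the
proved sibling crux `GradedPricing`), so S1 upgrades the route's wall to the EQUALITY `dim J = Σ_J d²`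
used informally everywhere in the route. Why it might fail: it does not (Wedderburn); size M with the
tree's `WedderburnBlocks` / `IsotypicProjector` API. [cite: folklore (Serre §6.2); tree
`Literature.RepresentationTheory.FiniteGroups.WedderburnBlocks`, `…GradedPricing.le_repFun_charSupport`] -/
def BlockContainment : Prop :=
  ∀ (G : Type) [Group G] [Fintype G] (J : Submodule ℂ (G → ℂ)),
    (∀ f ∈ J, ∀ a b : G, (fun g : G => f (a * g * b)) ∈ J) →
      (∑ᶠ χ ∈ Literature.RepresentationTheory.FiniteGroups.irrChars G ∩ (J : Set (G → ℂ)),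
          (χ 1).re ^ (2 : ℝ)) ≤ (Module.finrank ℂ J : ℝ)

/-- Registered stub S1 (statement = `BlockContainment`, tree-only vocabulary) — CLOSED: landed as
`Theorems.GradedDesignFamily.stub_blockContainment` (p120556, lead c2 wave 1). -/
theorem stub_blockContainment :
    ∀ (G : Type) [Group G] [Fintype G] (J : Submodule ℂ (G → ℂ)),
      (∀ f ∈ J, ∀ a b : G, (fun g : G => f (a * g * b)) ∈ J) →
        (∑ᶠ χ ∈ Literature.RepresentationTheory.FiniteGroups.irrChars G ∩ (J : Set (G → ℂ)),
            (χ 1).re ^ (2 : ℝ)) ≤ (Module.finrank ℂ J : ℝ) :=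
  -- LANDED (p120556): Theorems/LevelGradedCohnUmansGradedDesignFamilyStubBlockContainment.lean
  Summit.MatrixMultiplication.MatrixMultiplication.Theorems.GradedDesignFamily.stub_blockContainment

/-! ## S2 — structure of the level-one space of `GL₂(K)` (size M) -/

/-- **S2 `FrameStructure`.** For every finite field `K` (`Q = |K|`): (i) the frame functions are spanned
by `≤ Q³ + Q²` functions (constants and the indicators `g ↦ [g u_ℓ = v]`, one probe `u_ℓ` per point
`ℓ ∈ P¹(K)`, `v ∈ K² ∖ 0`: `1 + (Q+1)(Q²−1)` functions; `[g(λu) = v] = [g u = λ⁻¹v]`), so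
`dim F₁ ≤ Q³ + Q²` (truth: `Q³+Q²−3Q−1`); (ii) every irreducible character lying in `F₁` has degree
`≤ Q + 1`: `F₁` is the coefficient space of the permutation module `ℂ[K²] = ℂδ₀ ⊕ ⊕_{θ ∈ (K^×)^} ℂ[K²∖0]_θ`
whose homogeneity eigenspaces `ℂ[K²∖0]_θ` are `GL₂(K)`-stable of dimension `Q + 1`, and an irreducible
character in the coefficient space of `V` is the character of a constituent of `V` (Schur
orthogonality of matrix coefficients). Exact form (not needed): `Irr ∩ F₁ = {1, St, π(1,θ)}`,
James–Liebeck Ex. 29.3 = tree fact `JamesLiebeck2001_ex29_3` (any finite field). Why it might fail: it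
does not; size M (the tree has isotypic projectors and `IsIrrChar`, no matrix-coefficient
orthogonality yet). [cite: JamesLiebeck2001 Thm 28.5 + Ex 29.3 (tree `GL2PermutationCharacter`);
BlasiakCohnGrochowPrattUmans2024 §3 (frame/permutation-module form)] -/
def FrameStructure : Prop :=
  ∀ (K : Type) [Field K] [Fintype K] [DecidableEq K],
    (∃ B : Finset (GL2 K → ℂ), B.card ≤ Fintype.card K ^ 3 + Fintype.card K ^ 2 ∧
        ∀ c : (Fin 2 → K) → (Fin 2 → K) → ℂ, frameFn c ∈ Submodule.span ℂ (B : Set (GL2 K → ℂ))) ∧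
    ∀ χ ∈ Literature.RepresentationTheory.FiniteGroups.irrChars (GL2 K),
      (∃ c : (Fin 2 → K) → (Fin 2 → K) → ℂ, ∀ g, χ g = frameFn c g) →
        (χ 1).re ≤ (Fintype.card K : ℝ) + 1

/-- Registered stub S2 (statement = `FrameStructure`, tree-only vocabulary) — CLOSED: landed as
`Theorems.GradedDesignFamily.stub_frameStructure` (p120581, lead c2 wave 1). -/
theorem stub_frameStructure :
    ∀ (K : Type) [Field K] [Fintype K] [DecidableEq K],
      (∃ B : Finset (Matrix.GeneralLinearGroup (Fin 2) K → ℂ),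
          B.card ≤ Fintype.card K ^ 3 + Fintype.card K ^ 2 ∧
          ∀ c : (Fin 2 → K) → (Fin 2 → K) → ℂ,
            (fun g : Matrix.GeneralLinearGroup (Fin 2) K =>
                ∑ u : Fin 2 → K, c u ((g : Matrix (Fin 2) (Fin 2) K).mulVec u)) ∈
              Submodule.span ℂ (B : Set (Matrix.GeneralLinearGroup (Fin 2) K → ℂ))) ∧
      ∀ χ ∈ Literature.RepresentationTheory.FiniteGroups.irrChars (Matrix.GeneralLinearGroup (Fin 2) K),
        (∃ c : (Fin 2 → K) → (Fin 2 → K) → ℂ, ∀ g : Matrix.GeneralLinearGroup (Fin 2) K,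
            χ g = ∑ u : Fin 2 → K, c u ((g : Matrix (Fin 2) (Fin 2) K).mulVec u)) →
          (χ 1).re ≤ (Fintype.card K : ℝ) + 1 :=
  -- LANDED (p120581): Theorems/LevelGradedCohnUmansGradedDesignFamilyStubFrameStructure.lean
  Summit.MatrixMultiplication.MatrixMultiplication.Theorems.GradedDesignFamily.stub_frameStructure

/-! ## S3 — the quadratic-extension cell (the closer; size XL, open) -/

/-- **S3 `SubfieldCellFamily` — THE CLOSER (the card's Transfer `C⁺` run with its algebraic outer
piece).** There is `c > 0` such that for unboundedly large finite fields `K ⊇ k` with `|K| = |k|²`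
(`Q = q²`) and an embedding `φ : SL₂(k) ↪ GL₂(K)` (the subfield subgroup, or `SU₂(k)`, or any
conjugate: `|X| = q³ − q ≈ Q^{3/2} = √D₁`, the critical size), there are SETS `Y, Z ⊆ GL₂(K)` with
`|Y|, |Z| ≥ c·Q^{3/2}` such that for every `z₀ ∈ Z` ONE frame function `F_{z₀}` reads
`F_{z₀}(φ(a)·y·y'⁻¹·z) = [a = 1 ∧ y = y' ∧ z = z₀]` on `SL₂(k) × Y × Y × Z` — the ONE-SUBGROUP
IDENTITY-TEST form of level-one separation of `(φ(SL₂ k), Y, Z)` (`|Z|` conditions instead of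
`|X||Z|`; equivalent to it by left-invariance, `frameSeparated_image` below). Any constant `c` works
for the crux (universality), so the design may live inside determinant slices `SL₂(K)·g` (the card's
"sliced horn", wall `D′ ≈ Q³/2`) or spread over `GL₂(K)` with `F₁`-degenerate garbage (the
"degenerate horn"); the H-equivariant graded Neumann count (triage r1-1 App. A) costs only `(1−1/q)²`.
Why it might fail: every construction at this scale needs `F₁`-DEPENDENT garbage (footprint
`|SL₂(k)·YY⁻¹·Z| ≫ D`) or a folded footprint inside one `SL₂(K)`-coset with `δ_{z₀} ∈ F₁|_P` — never
exhibited in any (2,1) cell; a graded mixing bound `V ≲ D^{3/2}/√d_min` or an effective product-theorem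
localisation (card F3) would kill it.  UPDATE (lead c2, 2026-08-16): the folded ("sliced") horn is
DEAD — if `det` is constant on `Y` and on `Z` then `|φ(SL₂ k)||Y||Z| ≤ √2·|SL₂ K|^{3/2}/√(|K|−1) + |SL₂ K|
≈ √2·Q⁴ ≪ c²Q^{9/2}` (quasirandomness of `SL₂(K)`, BCGPU 2023 Thm 3.2, with the Frobenius bound
`n(SL₂ K) ≥ (|K|−1)/2`, all LANDED: `Theorems/GradedDesignFamily/Negative/{SlicedHorn, SL2Generators,
SL2MinDegree}.lean`, `slicedHorn_card_mul_le_uncond`); witnesses must be SPREAD over `≳ c·Q^{1/4}`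
determinant classes (lead's assessment `Lines/quadratic-extension-level-one-cell-S3.md`). [cite: CohnUmans2003 Prop 11 (arXiv:math/0307321, `SU₂(𝔽_q) <
SL₂(𝔽_{q²})`); BlasiakCohnGrochowPrattUmans2024 Def 2.1/Thm 2.2 (arXiv:2410.14905); Helfgott2008] -/
def SubfieldCellFamily : Prop :=
  ∃ c : ℝ, 0 < c ∧ ∀ N : ℕ, ∃ (k K : Type) (_ : Field k) (_ : Fintype k) (_ : DecidableEq k)
    (_ : Field K) (_ : Fintype K) (_ : DecidableEq K)
    (φ : Matrix.SpecialLinearGroup (Fin 2) k →* GL2 K),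
    Function.Injective φ ∧ Fintype.card K = Fintype.card k ^ 2 ∧ N ≤ Fintype.card K ∧
    ∃ Y Z : Finset (GL2 K),
      c * (Fintype.card K : ℝ) ^ (3 / 2 : ℝ) ≤ (Finset.univ.image φ).card ∧
      c * (Fintype.card K : ℝ) ^ (3 / 2 : ℝ) ≤ Y.card ∧
      c * (Fintype.card K : ℝ) ^ (3 / 2 : ℝ) ≤ Z.card ∧
      ∀ z₀ ∈ Z, ∃ cf : (Fin 2 → K) → (Fin 2 → K) → ℂ,
        ∀ a : Matrix.SpecialLinearGroup (Fin 2) k, ∀ y ∈ Y, ∀ y' ∈ Y, ∀ z ∈ Z,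
          frameFn cf (φ a * y * y'⁻¹ * z) = if a = 1 ∧ y = y' ∧ z = z₀ then 1 else 0

/-- Registered stub S3 (statement = `SubfieldCellFamily`, tree-only vocabulary). -/
theorem stub_subfieldCell :
    ∃ c : ℝ, 0 < c ∧ ∀ N : ℕ, ∃ (k K : Type) (_ : Field k) (_ : Fintype k) (_ : DecidableEq k)
      (_ : Field K) (_ : Fintype K) (_ : DecidableEq K)
      (φ : Matrix.SpecialLinearGroup (Fin 2) k →* Matrix.GeneralLinearGroup (Fin 2) K),
      Function.Injective φ ∧ Fintype.card K = Fintype.card k ^ 2 ∧ N ≤ Fintype.card K ∧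
      ∃ Y Z : Finset (Matrix.GeneralLinearGroup (Fin 2) K),
        c * (Fintype.card K : ℝ) ^ (3 / 2 : ℝ) ≤ (Finset.univ.image φ).card ∧
        c * (Fintype.card K : ℝ) ^ (3 / 2 : ℝ) ≤ Y.card ∧
        c * (Fintype.card K : ℝ) ^ (3 / 2 : ℝ) ≤ Z.card ∧
        ∀ z₀ ∈ Z, ∃ cf : (Fin 2 → K) → (Fin 2 → K) → ℂ,
          ∀ a : Matrix.SpecialLinearGroup (Fin 2) k, ∀ y ∈ Y, ∀ y' ∈ Y, ∀ z ∈ Z,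
            (∑ u : Fin 2 → K, cf u (((φ a * y * y'⁻¹ * z : Matrix.GeneralLinearGroup (Fin 2) K) :
                Matrix (Fin 2) (Fin 2) K).mulVec u)) =
              if a = 1 ∧ y = y' ∧ z = z₀ then 1 else 0 := by
  sorry

/-! ### Registered-stub aliases (hypothesis heads of `GradedDesignFamily_of` are matched BY NAME) -/
namespace Registered

/-- Statement of registered stub S1. -/
abbrev stub_blockContainment : Prop := BlockContainment
/-- Statement of registered stub S2. -/
abbrev stub_frameStructure : Prop := FrameStructure
/-- Statement of registered stub S3. -/
abbrev stub_subfieldCell : Prop := SubfieldCellFamily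

end Registered

/-! ## Glue 1 (proved): the one-subgroup identity test — S3 ⇒ Transfer `C⁺` -/

section OneSubgroup

variable {k K : Type} [Field k] [Fintype k] [DecidableEq k] [Field K] [Fintype K] [DecidableEq K]

/-- **One-subgroup identity test** (card First lemma (b), ideator-proved for abstract `J`; here for the
image of an injective hom `φ : SL₂(k) →* GL₂(K)` and frame functions): separators for the targets
`(1, z₀)` give separators for every target `(φ a₀, z₀)` by LEFT translation `g ↦ F_{z₀}(φ(a₀) g)`,
which is again a frame function (table `(u, v) ↦ cf u (φ(a₀) v)`). -/
theorem frameSeparated_image (φ : Matrix.SpecialLinearGroup (Fin 2) k →* GL2 K)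
    (hφ : Function.Injective φ) (Y Z : Finset (GL2 K))
    (hsep : ∀ z₀ ∈ Z, ∃ cf : (Fin 2 → K) → (Fin 2 → K) → ℂ,
      ∀ a : Matrix.SpecialLinearGroup (Fin 2) k, ∀ y ∈ Y, ∀ y' ∈ Y, ∀ z ∈ Z,
        frameFn cf (φ a * y * y'⁻¹ * z) = if a = 1 ∧ y = y' ∧ z = z₀ then 1 else 0) :
    FrameSeparated (Finset.univ.image φ) Y Z := by
  intro x₀ hx₀ z₀ hz₀
  obtain ⟨a₀, -, rfl⟩ := Finset.mem_image.1 hx₀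
  obtain ⟨cf, hcf⟩ := hsep z₀ hz₀
  refine ⟨fun u v => cf u ((φ a₀ : Matrix (Fin 2) (Fin 2) K).mulVec v),
    fun x hx y hy y' hy' z hz => ?_⟩
  obtain ⟨a, -, rfl⟩ := Finset.mem_image.1 hx
  have hg : φ a₀ * ((φ a)⁻¹ * y * y'⁻¹ * z) = φ (a₀ * a⁻¹) * y * y'⁻¹ * z := by
    rw [map_mul, map_inv]; simp only [mul_assoc]
  have h1 : frameFn (fun u v => cf u ((φ a₀ : Matrix (Fin 2) (Fin 2) K).mulVec v))
      ((φ a)⁻¹ * y * y'⁻¹ * z) = frameFn cf (φ (a₀ * a⁻¹) * y * y'⁻¹ * z) := by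
    unfold frameFn
    refine Finset.sum_congr rfl fun u _ => ?_
    dsimp only
    rw [Matrix.mulVec_mulVec, ← Units.val_mul, hg]
  rw [h1, hcf (a₀ * a⁻¹) y hy y' hy' z hz]
  by_cases h : φ a = φ a₀ ∧ y = y' ∧ z = z₀
  · rw [if_pos h, if_pos ⟨mul_inv_eq_one.2 (hφ h.1).symm, h.2⟩]
  · rw [if_neg h, if_neg fun h' => h ⟨(congrArg φ (mul_inv_eq_one.1 h'.1)).symm, h'.2⟩]

/-- Converse (so that S3's one-subgroup form loses nothing): level-one separation of
`(φ(SL₂ k), Y, Z)` gives the one-subgroup separators (target `x₀ = φ 1`, quadruple `x = φ a⁻¹`).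
Hence S3 is EQUIVALENT to the card's Transfer `C⁺` run with the outer piece `X = φ(SL₂ k)`. -/
theorem oneSubgroup_of_frameSeparated (φ : Matrix.SpecialLinearGroup (Fin 2) k →* GL2 K)
    (hφ : Function.Injective φ) (Y Z : Finset (GL2 K))
    (hsep : FrameSeparated (Finset.univ.image φ) Y Z) :
    ∀ z₀ ∈ Z, ∃ cf : (Fin 2 → K) → (Fin 2 → K) → ℂ,
      ∀ a : Matrix.SpecialLinearGroup (Fin 2) k, ∀ y ∈ Y, ∀ y' ∈ Y, ∀ z ∈ Z,
        frameFn cf (φ a * y * y'⁻¹ * z) = if a = 1 ∧ y = y' ∧ z = z₀ then 1 else 0 := by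
  intro z₀ hz₀
  obtain ⟨cf, hcf⟩ := hsep (φ 1) (Finset.mem_image_of_mem φ (Finset.mem_univ _)) z₀ hz₀
  refine ⟨cf, fun a y hy y' hy' z hz => ?_⟩
  have key := hcf (φ a⁻¹) (Finset.mem_image_of_mem φ (Finset.mem_univ _)) y hy y' hy' z hz
  rw [map_inv, inv_inv] at key
  simp only [map_one, inv_eq_one, map_eq_one_iff φ hφ] at key
  exact key

end OneSubgroup

/-- **S3 ⇒ Transfer `C⁺`**: the quadratic-extension cell is a level-one family (take
`X := φ(SL₂ k)` as a finset; one-subgroup test). -/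
theorem levelOneFrameFamily_of_subfieldCell (h : SubfieldCellFamily) : LevelOneFrameFamily := by
  obtain ⟨c, hc, hall⟩ := h
  refine ⟨c, hc, fun N => ?_⟩
  obtain ⟨k, K, _, _, _, _, _, _, φ, hφ, -, hN, Y, Z, hX, hY, hZ, hsep⟩ := hall N
  exact ⟨K, inferInstance, inferInstance, inferInstance, hN, Finset.univ.image φ, Y, Z,
    frameSeparated_image φ hφ Y Z hsep, hX, hY, hZ⟩

/-! ## Glue 2 (proved): the graded budget of the level-one host from S1 + S2 -/

section Budget

variable (K : Type) [Field K] [Fintype K] [DecidableEq K]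

/-- `dim F₁(K) ≤ Q³ + Q²` (from S2 (i)). -/
theorem finrank_frameSpace_le (h₂ : FrameStructure) :
    (Module.finrank ℂ (frameSpace K) : ℝ) ≤ (Fintype.card K : ℝ) ^ 3 + (Fintype.card K : ℝ) ^ 2 := by
  obtain ⟨⟨B, hB, hspan⟩, -⟩ := h₂ K
  have hle : frameSpace K ≤ Submodule.span ℂ (B : Set (GL2 K → ℂ)) := by
    rintro f ⟨c, hc⟩
    have : f = frameFn c := funext hc
    rw [this]
    exact hspan c
  have h1 : Module.finrank ℂ (frameSpace K) ≤ B.card :=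
    (Submodule.finrank_mono hle).trans (finrank_span_finset_le_card B)
  exact_mod_cast h1.trans hB

/-- **The level-one budget over any finite field** (S1 + S2): for `s ≥ 2`,
`Σ_{χ ∈ Irr(GL₂ K) ∩ F₁} χ(1)^s ≤ (Q+1)^{s−2} · (Q³ + Q²)` (truth: `1 + Q^s + (Q−2)(Q+1)^s`). -/
theorem frameBudget_le (h₁ : BlockContainment) (h₂ : FrameStructure) (s : ℝ) (hs : 2 ≤ s) :
    (∑ᶠ χ ∈ irrChars (GL2 K) ∩ (frameSpace K : Set (GL2 K → ℂ)), (χ 1).re ^ s) ≤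
      ((Fintype.card K : ℝ) + 1) ^ (s - 2) * ((Fintype.card K : ℝ) ^ 3 + (Fintype.card K : ℝ) ^ 2) := by
  set Q : ℝ := (Fintype.card K : ℝ) with hQ
  have hQ0 : 0 ≤ Q := by positivity
  have hfin : (irrChars (GL2 K) ∩ (frameSpace K : Set (GL2 K → ℂ))).Finite :=
    (irrChars_finite_holds (GL2 K)).subset Set.inter_subset_left
  have hdeg := (h₂ K).2
  -- termwise: d^s ≤ (Q+1)^(s-2) · d^2
  have hterm : ∀ χ ∈ hfin.toFinset, (χ 1).re ^ s ≤ (Q + 1) ^ (s - 2) * (χ 1).re ^ (2 : ℝ) := by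
    intro χ hχ
    obtain ⟨hirr, hmem⟩ := hfin.mem_toFinset.1 hχ
    obtain ⟨d, -, hd⟩ := IsIrrChar.exists_apply_one hirr
    have hd0 : 0 ≤ (χ 1).re := by rw [hd]; simp
    have hdQ : (χ 1).re ≤ Q + 1 := hdeg χ hirr hmem
    have hsplit : (χ 1).re ^ s = (χ 1).re ^ (s - 2) * (χ 1).re ^ (2 : ℝ) := by
      rw [← Real.rpow_add_of_nonneg hd0 (by linarith) (by norm_num)]
      congr 1; ring
    rw [hsplit]
    exact mul_le_mul_of_nonneg_right (Real.rpow_le_rpow hd0 hdQ (by linarith))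
      (Real.rpow_nonneg hd0 _)
  have hsum2 : (∑ χ ∈ hfin.toFinset, (χ 1).re ^ (2 : ℝ)) ≤ (Module.finrank ℂ (frameSpace K) : ℝ) := by
    rw [← finsum_mem_eq_finite_toFinset_sum _ hfin]
    exact h₁ (GL2 K) (frameSpace K) (frameSpace_biInv K)
  calc (∑ᶠ χ ∈ irrChars (GL2 K) ∩ (frameSpace K : Set (GL2 K → ℂ)), (χ 1).re ^ s)
        = ∑ χ ∈ hfin.toFinset, (χ 1).re ^ s := finsum_mem_eq_finite_toFinset_sum _ hfin
    _ ≤ ∑ χ ∈ hfin.toFinset, (Q + 1) ^ (s - 2) * (χ 1).re ^ (2 : ℝ) := Finset.sum_le_sum hterm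
    _ = (Q + 1) ^ (s - 2) * ∑ χ ∈ hfin.toFinset, (χ 1).re ^ (2 : ℝ) := by rw [Finset.mul_sum]
    _ ≤ (Q + 1) ^ (s - 2) * (Module.finrank ℂ (frameSpace K) : ℝ) :=
        mul_le_mul_of_nonneg_left hsum2 (Real.rpow_nonneg (by linarith) _)
    _ ≤ (Q + 1) ^ (s - 2) * (Q ^ 3 + Q ^ 2) :=
        mul_le_mul_of_nonneg_left (finrank_frameSpace_le K h₂) (Real.rpow_nonneg (by linarith) _)

/-- The budget in the shape the universality bookkeeping consumes: `≤ 2^s · Q^{1+s}` for `s ≥ 2`. -/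
theorem frameBudget_le_pow (h₁ : BlockContainment) (h₂ : FrameStructure) (s : ℝ) (hs : 2 ≤ s) :
    (∑ᶠ χ ∈ irrChars (GL2 K) ∩ (frameSpace K : Set (GL2 K → ℂ)), (χ 1).re ^ s) ≤
      (2 : ℝ) ^ s * (Fintype.card K : ℝ) ^ (1 + s) := by
  set Q : ℝ := (Fintype.card K : ℝ) with hQ
  have hQ1 : 1 ≤ Q := by
    rw [hQ]; exact_mod_cast Fintype.card_pos
  have hQ0 : 0 < Q := by linarith
  refine (frameBudget_le K h₁ h₂ s hs).trans ?_
  -- (Q+1)^(s-2) (Q³+Q²) = Q² (Q+1)^(s-1) ≤ Q² (2Q)^(s-1) = 2^(s-1) Q^(s+1) ≤ 2^s Q^(1+s)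
  have h1 : (Q + 1) ^ (s - 2) * (Q ^ 3 + Q ^ 2) = Q ^ 2 * (Q + 1) ^ (s - 1) := by
    have : (Q + 1) ^ (s - 1) = (Q + 1) ^ (s - 2) * (Q + 1) := by
      rw [← Real.rpow_add_one (by linarith : (Q + 1) ≠ 0)]; congr 1; ring
    rw [this]; ring
  have h2 : (Q + 1) ^ (s - 1) ≤ (2 : ℝ) ^ (s - 1) * Q ^ (s - 1) := by
    rw [← Real.mul_rpow (by norm_num) hQ0.le]
    exact Real.rpow_le_rpow (by linarith) (by linarith) (by linarith)
  have h3 : Q ^ 2 * Q ^ (s - 1) = Q ^ (1 + s) := by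
    rw [show (Q ^ 2 : ℝ) = Q ^ (2 : ℝ) by norm_cast, ← Real.rpow_add hQ0]; congr 1; ring
  have h4 : (2 : ℝ) ^ (s - 1) ≤ (2 : ℝ) ^ s :=
    Real.rpow_le_rpow_of_exponent_le (by norm_num) (by linarith)
  calc (Q + 1) ^ (s - 2) * (Q ^ 3 + Q ^ 2) = Q ^ 2 * (Q + 1) ^ (s - 1) := h1
    _ ≤ Q ^ 2 * ((2 : ℝ) ^ (s - 1) * Q ^ (s - 1)) := mul_le_mul_of_nonneg_left h2 (by positivity)
    _ = (2 : ℝ) ^ (s - 1) * (Q ^ 2 * Q ^ (s - 1)) := by ring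
    _ = (2 : ℝ) ^ (s - 1) * Q ^ (1 + s) := by rw [h3]
    _ ≤ (2 : ℝ) ^ s * Q ^ (1 + s) :=
        mul_le_mul_of_nonneg_right h4 (Real.rpow_nonneg hQ0.le _)

end Budget

/-! ## Glue 3 (proved): universality of the fixed cell — S1 + S2 + Transfer `C⁺` ⇒ crux -/

/-- **Prime-power universality of the smallest Lie cell** (card First lemma (a) =
`cruxFamily_of_finiteFieldLevelOne`, here `cruxBody_of_frameFamily`; the route's `LevelOneLink` + `LieEngineLink` with `ZMod p`
replaced by an arbitrary finite field, ported from the chain's kernel-checked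
`LieRankDesigns_of_levelOneGL2`): the host `(GL₂(K), F₁(K))` is bi-invariant, the frame separators are
`F₁`-separators verbatim, and the budget `≤ 2^{2+ε} Q^{3+ε}` loses to `V^{(2+ε)/3} ≥ c^{2+ε} Q^{3+3ε/2}`
once `Q^{ε/2} > (2/c)^{2+ε}` — `N_eff ≈ Q` equal blocks at FIXED `(m,k) = (2,1)`. -/
theorem cruxBody_of_frameFamily (h₁ : BlockContainment) (h₂ : FrameStructure)
    (hdesign : LevelOneFrameFamily) :
    ∀ ε : ℝ, 0 < ε → ∃ (G : Type) (_ : Group G) (_ : Fintype G) (J : Submodule ℂ (G → ℂ))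
      (X Y Z : Finset G), (∀ f ∈ J, ∀ a b : G, (fun g : G => f (a * g * b)) ∈ J) ∧
      (∀ x₀ ∈ X, ∀ z₀ ∈ Z, ∃ f ∈ J, ∀ x ∈ X, ∀ y ∈ Y, ∀ y' ∈ Y, ∀ z ∈ Z,
        (x = x₀ ∧ y = y' ∧ z = z₀ → f (x⁻¹ * y * y'⁻¹ * z) = 1) ∧
        (¬ (x = x₀ ∧ y = y' ∧ z = z₀) → f (x⁻¹ * y * y'⁻¹ * z) = 0)) ∧
      (∑ᶠ χ ∈ Literature.RepresentationTheory.FiniteGroups.irrChars G ∩ (J : Set (G → ℂ)),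
        (χ 1).re ^ (2 + ε)) < ((X.card * Y.card * Z.card : ℕ) : ℝ) ^ ((2 + ε) / 3) := by
  -- (the body of `GradedDesignFamily`, unfolded so that `GradedDesignFamily_of` below is the only
  -- theorem of this file concluding the crux by name)
  intro ε hε
  obtain ⟨c, hc, hall⟩ := hdesign
  set s : ℝ := 2 + ε with hs_def
  have hs : 0 < s := by rw [hs_def]; linarith
  have hs2 : 2 ≤ s := by rw [hs_def]; linarith
  set L : ℝ := (2 / c) ^ s with hL_def
  have hL : 0 ≤ L := by rw [hL_def]; positivity
  obtain ⟨N, hN⟩ := exists_nat_gt (max 1 (L ^ (2 / ε)))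
  obtain ⟨K, instF, instFt, instD, hNK, X, Y, Z, hsep, hX, hY, hZ⟩ := hall N
  set Q : ℝ := (Fintype.card K : ℝ) with hQ_def
  have hNR : (N : ℝ) ≤ Q := by rw [hQ_def]; exact_mod_cast hNK
  have hQ1 : (1 : ℝ) < Q := lt_of_lt_of_le (lt_of_le_of_lt (le_max_left _ _) hN) hNR
  have hQL : L ^ (2 / ε) < Q := lt_of_lt_of_le (lt_of_le_of_lt (le_max_right _ _) hN) hNR
  have hQ0 : (0 : ℝ) < Q := by linarith
  -- the key threshold: L < Q ^ (ε/2)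
  have hLQ : L < Q ^ (ε / 2) := by
    have h1 : (L ^ (2 / ε)) ^ (ε / 2) < Q ^ (ε / 2) :=
      Real.rpow_lt_rpow (by positivity) hQL (by positivity)
    have h2 : (L ^ (2 / ε)) ^ (ε / 2) = L := by
      rw [← Real.rpow_mul hL]
      have : (2 / ε) * (ε / 2) = 1 := by field_simp
      rw [this, Real.rpow_one]
    rwa [h2] at h1
  refine ⟨GL2 K, inferInstance, inferInstance, frameSpace K, X, Y, Z, frameSpace_biInv K, ?_, ?_⟩
  · -- separation: frame separators are `F₁`-separators verbatim
    intro x₀ hx₀ z₀ hz₀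
    obtain ⟨cf, hcf⟩ := hsep x₀ hx₀ z₀ hz₀
    refine ⟨frameFn cf, frameFn_mem cf, fun x hx y hy y' hy' z hz => ⟨fun h => ?_, fun h => ?_⟩⟩
    · exact (hcf x hx y hy y' hy' z hz).trans (if_pos h)
    · exact (hcf x hx y hy y' hy' z hz).trans (if_neg h)
  · -- budget < volume^{s/3}
    have hB := frameBudget_le_pow K h₁ h₂ s hs2
    change (∑ᶠ χ ∈ irrChars (GL2 K) ∩ (frameSpace K : Set (GL2 K → ℂ)), (χ 1).re ^ s) <
      ((X.card * Y.card * Z.card : ℕ) : ℝ) ^ (s / 3)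
    -- lower bound for the volume side
    have hc32 : 0 < c * Q ^ (3 / 2 : ℝ) := by positivity
    have hXpos : (0 : ℝ) < X.card := lt_of_lt_of_le hc32 hX
    have hYpos : (0 : ℝ) < Y.card := lt_of_lt_of_le hc32 hY
    have hZpos : (0 : ℝ) < Z.card := lt_of_lt_of_le hc32 hZ
    have hV : (c * Q ^ (3 / 2 : ℝ)) ^ (3 : ℕ) ≤ ((X.card * Y.card * Z.card : ℕ) : ℝ) := by
      push_cast
      have := mul_le_mul (mul_le_mul hX hY hc32.le hXpos.le) hZ hc32.le (by positivity)
      nlinarith [this]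
    have hV' : ((c * Q ^ (3 / 2 : ℝ)) ^ (3 : ℕ)) ^ (s / 3) ≤
        ((X.card * Y.card * Z.card : ℕ) : ℝ) ^ (s / 3) :=
      Real.rpow_le_rpow (by positivity) hV (by positivity)
    have hV'' : ((c * Q ^ (3 / 2 : ℝ)) ^ (3 : ℕ)) ^ (s / 3) = c ^ s * (Q ^ (1 + s) * Q ^ (ε / 2)) := by
      rw [← Real.rpow_natCast, ← Real.rpow_mul hc32.le]
      have h3 : ((3 : ℕ) : ℝ) * (s / 3) = s := by push_cast; ring
      rw [h3, Real.mul_rpow hc.le (by positivity), ← Real.rpow_mul hQ0.le, ← Real.rpow_add hQ0]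
      congr 1
      congr 1
      rw [hs_def]; ring
    -- combine
    have hfinal : (2 : ℝ) ^ s * Q ^ (1 + s) < c ^ s * (Q ^ (1 + s) * Q ^ (ε / 2)) := by
      have hcs : 0 < c ^ s := Real.rpow_pos_of_pos hc s
      have hQ1s : 0 < Q ^ (1 + s) := Real.rpow_pos_of_pos hQ0 _
      have hLc : c ^ s * L = (2 : ℝ) ^ s := by
        rw [hL_def, Real.div_rpow (by norm_num) hc.le]
        field_simp
      calc (2 : ℝ) ^ s * Q ^ (1 + s) = c ^ s * (Q ^ (1 + s) * L) := by rw [← hLc]; ring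
        _ < c ^ s * (Q ^ (1 + s) * Q ^ (ε / 2)) := by gcongr
    calc (∑ᶠ χ ∈ irrChars (GL2 K) ∩ (frameSpace K : Set (GL2 K → ℂ)), (χ 1).re ^ s)
          ≤ (2 : ℝ) ^ s * Q ^ (1 + s) := hB
      _ < c ^ s * (Q ^ (1 + s) * Q ^ (ε / 2)) := hfinal
      _ = ((c * Q ^ (3 / 2 : ℝ)) ^ (3 : ℕ)) ^ (s / 3) := hV''.symm
      _ ≤ ((X.card * Y.card * Z.card : ℕ) : ℝ) ^ (s / 3) := hV'

/-! ## The composition (proved): S1 → S2 → S3 → crux, BY NAME -/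

/-- **The skeleton closes the crux modulo the registered stubs**: S3 (the quadratic-extension cell) is
a level-one family by the one-subgroup test; S1 + S2 price the level-one host over any finite field;
universality turns constant-factor wall saturation at the fixed cell into every `ε`. -/
theorem GradedDesignFamily_of (h₃ : Registered.stub_subfieldCell) :
    Summit.MatrixMultiplication.MatrixMultiplication.Theses.LevelGradedCohnUmans.GradedDesignFamily :=
  -- S1 and S2 are LANDED theorems (lead c2, wave 1: p120556, p120581), so the composition now
  -- closes the crux modulo the single design stub S3.
  cruxBody_of_frameFamily stub_blockContainment stub_frameStructure
    (levelOneFrameFamily_of_subfieldCell h₃)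

/-- How the closed proof is obtained once S3 lands (an `example`, so that
`GradedDesignFamily_of` is the only theorem of this file concluding the crux; it also certifies that the
tree-only spelling of the registered stub is definitionally the named statement). -/
example : Summit.MatrixMultiplication.MatrixMultiplication.Theses.LevelGradedCohnUmans.GradedDesignFamily :=
  GradedDesignFamily_of stub_subfieldCell

end Summit.MatrixMultiplication.MatrixMultiplication.Cruxes.GradedDesignFamily.QuadraticExtensionLevelOneCell

end
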